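import Summits.QuantumFields.YangMills.Theorems.BalabanLadderInfVolRPSquare
import Summits.QuantumFields.YangMills.Theorems.LangevinControlUVOSLegsFromFemtoAndGapStubAssemblyRPLimit
import HarnessLib

/-!
# Infinite-volume reflection positivity, II: expansion and reindexing of the RP square of a `ℤ⁴` state

R136 (i) «infinite-volume ∕ continuum-from-UV» programme (director-ym), prover seat `ym-infvol-p3`, pre-birth
support filed `--supports` the spine leg `UV` (stmt-QuantumFields-19351) of `route-QuantumFields-BalabanLadder`.
HONEST FRAMING: conditional material for the EXISTENCE half (OS0–OS3 of a continuum limit); not a mass gap, not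
Clay; NOTHING is asserted about Yang–Mills — pure algebra of finite sums and Fubini for a FINITE measure `μ` on
`LGConfig 4 G`, continuing `BalabanLadderInfVolRPSquare.lean` (the `ℤ⁴` twin of the spine's torus toolkits
XVIII–XIX, `…StubAssemblyRPExpansion.lean` / `…StubAssemblyRPReindex.lean`, whose measure-free combinatorial
lemmas `sum_piFinset_comp_perm`, `revFirst`, `append_comp_revFirst` are imported, not re-proved).

* `strWeight r μ q m y = ∫ ∏ₗ (plane (q l) (y l) − m l) dμ` — the plane-string WEIGHT of the state (the
  infinite-volume analogue of the torus `torusMomentStr`), symmetric under joint permutations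
  (`strWeight_comp_perm`);
* `integral_rpSquare_eq`:
  `∫ conj(Σᵢ Xᵢ(ΘU)) · Σⱼ Xⱼ(U) dμ = Σᵢⱼ Σ_{q,p} Σ_{x,y} conj Fᵢ(a (x + o∘q)) Fⱼ(a (y + o∘p))
  · W_μ^{q ++ p}(reflSite∘x ++ y)` for the smeared fields `Xⱼ = fieldObs a B o Fⱼ m` (reflection law of the
  strings, product of strings = appended string, Fubini for finite sums);
* `sum_reflSite_eq` — the change of variables `x ↦ reflSite∘x` on the box for test functions with time support
  in `(0, T]`, `T + a ≤ a B`, and offsets with time components in `[0, 1)` (then every non-vanishing term has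
  its sites AND its reflected sites in the box);
* `rpTerm_eq_shifted`: after reversing the first block and changing variables, the `(i, j)` term is the string
  sum at the ACTUAL sites with `Fᵢ` evaluated at
  `ϑ(a (x∘rev + o∘q∘rev)) + a (2 (o (q (rev l)))₀ − [temporal]) e₀`
  — for plaquette-centre offsets the shift is zero and the square IS the lattice OS form (file III).

References: K. Osterwalder, E. Seiler, Ann. Phys. 110 (1978) 440, §2; J. Glimm, A. Jaffe, Quantum Physics (1987) §6.1.
-/

noncomputable section

open scoped SchwartzMap BigOperators ComplexConjugate
open MeasureTheory Filter Topology
open Literature.MathematicalPhysics.QuantumFieldTheory Literature.MathematicalPhysics.QuantumLattice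
open Literature.Probability.LatticeModels (box Site mem_box)
open Summit.QuantumFields.YangMills.Cruxes.OSLegsFromFemtoAndGap.DlrCollarTransfer (plane exists_abs_plane_le)
open Summit.QuantumFields.YangMills.Theorems.OSLegsFromFemtoAndGap
  (mem_planeStrings_iff'' sum_piFinset_comp_perm revFirst append_comp_revFirst)

namespace Summit.QuantumFields.YangMills.Theorems.InfVolRP

local notation "E4" => EuclideanSpace ℝ (Fin 4)

variable {G : Type} [Group G] [TopologicalSpace G] [IsTopologicalGroup G] [CompactSpace G]
  [MeasurableSpace G] [BorelSpace G]

/-! ### String weights of a state -/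

/-- **Plane-string weight of the state `μ`**: `W_μ(q, m, y) = ∫ ∏ₗ (plane (q l) (y l) U − m l) dμ(U)` (the
infinite-volume analogue of the torus weight `torusMomentStr`; for the centrings `m l = ∫ plane dμ` it is the
centred mixed plane moment bounded by the L-uniform form of `MomentBounds6`). -/
def strWeight (r : LatticeRep G) (μ : Measure (LGConfig 4 G)) {n : ℕ} (q : Fin n → Fin 4 × Fin 4)
    (m : Fin n → ℝ) (y : Fin n → Site 4) : ℝ :=
  ∫ U, strObs r q m y U ∂μ

omit [IsTopologicalGroup G] [CompactSpace G] [BorelSpace G] in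
/-- The string observable is invariant under a joint permutation of orientations, centrings and sites. -/
theorem strObs_comp_perm (r : LatticeRep G) {n : ℕ} (q : Fin n → Fin 4 × Fin 4) (m : Fin n → ℝ)
    (y : Fin n → Site 4) (σ : Equiv.Perm (Fin n)) (U : LGConfig 4 G) :
    strObs r (q ∘ σ) (m ∘ σ) (y ∘ σ) U = strObs r q m y U := by
  unfold strObs
  exact Fintype.prod_equiv σ (fun l => plane G r (q (σ l)) (y (σ l)) U - m (σ l))
    (fun l => plane G r (q l) (y l) U - m l) fun _ => rfl

omit [IsTopologicalGroup G] [CompactSpace G] [BorelSpace G] in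
/-- **The string weights are symmetric** under joint permutations. -/
theorem strWeight_comp_perm (r : LatticeRep G) (μ : Measure (LGConfig 4 G)) {n : ℕ} (q : Fin n → Fin 4 × Fin 4)
    (m : Fin n → ℝ) (y : Fin n → Site 4) (σ : Equiv.Perm (Fin n)) :
    strWeight r μ (q ∘ σ) (m ∘ σ) (y ∘ σ) = strWeight r μ q m y := by
  unfold strWeight
  simp_rw [strObs_comp_perm]

omit [IsTopologicalGroup G] [CompactSpace G] [BorelSpace G] in
/-- **Sup bound of the weights** of a probability measure: `|W| ≤ (Cₚ + Cₘ)ⁿ`. -/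
theorem abs_strWeight_le (r : LatticeRep G) (μ : Measure (LGConfig 4 G)) [IsProbabilityMeasure μ] {n : ℕ}
    (q : Fin n → Fin 4 × Fin 4) {m : Fin n → ℝ} {Cp Cm : ℝ}
    (hCp : ∀ (q : Fin 4 × Fin 4) (x : Fin 4 → ℤ) (U : LGConfig 4 G), |plane G r q x U| ≤ Cp)
    (hCm : ∀ l, |m l| ≤ Cm) (y : Fin n → Site 4) : |strWeight r μ q m y| ≤ (Cp + Cm) ^ n := by
  unfold strWeight
  refine (abs_integral_le_integral_abs).trans ?_
  refine (integral_mono_of_nonneg (Eventually.of_forall fun _ => abs_nonneg _) (integrable_const _)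
    (Eventually.of_forall fun U => abs_strObs_le r q hCp hCm y U)).trans ?_
  simp

/-! ### Integrability -/

omit [CompactSpace G] in
/-- String observables are integrable against a finite measure (bounded continuous functions). -/
theorem integrable_strObs [SecondCountableTopology G] (r : LatticeRep G) (μ : Measure (LGConfig 4 G))
    [IsFiniteMeasure μ] [CompactSpace G] {n : ℕ} (q : Fin n → Fin 4 × Fin 4) (m : Fin n → ℝ)
    (y : Fin n → Site 4) : Integrable (strObs r q m y) μ := by
  obtain ⟨Cp, hCp⟩ := exists_abs_plane_le (G := G) r
  refine Integrable.of_bound (measurable_strObs r q m y).aestronglyMeasurable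
    ((Cp + ∑ l, |m l|) ^ n) (Eventually.of_forall fun U => ?_)
  rw [Real.norm_eq_abs]
  exact abs_strObs_le r q hCp (fun l => Finset.single_le_sum (f := fun l => |m l|) (fun _ _ => abs_nonneg _)
    (Finset.mem_univ l)) y U

omit [CompactSpace G] in
/-- The complex summands of the square are integrable. -/
theorem integrable_rpTerm [SecondCountableTopology G] (r : LatticeRep G) (μ : Measure (LGConfig 4 G))
    [IsFiniteMeasure μ] [CompactSpace G] {n k : ℕ} (c : ℂ) (q : Fin n → Fin 4 × Fin 4)
    (p : Fin k → Fin 4 × Fin 4) (m₁ : Fin n → ℝ) (m₂ : Fin k → ℝ) (x : Fin n → Site 4)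
    (y : Fin k → Site 4) :
    Integrable (fun U : LGConfig 4 G => c * ((strObs r q m₁ x U * strObs r p m₂ y U : ℝ) : ℂ)) μ := by
  refine Integrable.const_mul ?_ c
  simp_rw [strObs_mul_strObs]
  exact (integrable_strObs r μ _ _ _).ofReal

/-! ### Expansion of the square -/

/-- **Expansion of the reflection-positivity square into string weights**:
`∫ conj(Σᵢ Xᵢ(ΘU)) Σⱼ Xⱼ(U) dμ
  = Σᵢⱼ Σ_{q,p} Σ_{x,y} conj Fᵢ(a (x + o∘q)) Fⱼ(a (y + o∘p)) W_μ^{q++p}(reflSite∘x ++ y)`. -/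
theorem integral_rpSquare_eq [SecondCountableTopology G] (r : LatticeRep G) (μ : Measure (LGConfig 4 G))
    [IsFiniteMeasure μ] (a : ℝ) (B : ℕ) (o : Fin 4 × Fin 4 → E4) {N : ℕ} {deg : Fin N → ℕ}
    (F : (j : Fin N) → 𝓢((Fin (deg j) → E4), ℂ)) (m : Fin 4 × Fin 4 → ℝ) :
    ∫ U, conj (∑ j, fieldObs r a B o (F j) m (cfgReflect U)) * ∑ j, fieldObs r a B o (F j) m U ∂μ =
      ∑ i, ∑ j,
        ∑ q ∈ Fintype.piFinset (fun _ : Fin (deg i) => Finset.univ.filter fun pl : Fin 4 × Fin 4 => pl.1 < pl.2),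
        ∑ p ∈ Fintype.piFinset (fun _ : Fin (deg j) => Finset.univ.filter fun pl : Fin 4 × Fin 4 => pl.1 < pl.2),
        ∑ x ∈ Fintype.piFinset (fun _ : Fin (deg i) => box 4 B),
        ∑ y ∈ Fintype.piFinset (fun _ : Fin (deg j) => box 4 B),
          conj (F i (fun l => a • (siteToE (x l) + o (q l)))) * F j (fun l => a • (siteToE (y l) + o (p l))) *
            (strWeight r μ (Fin.append q p) (Fin.append (fun l => m (q l)) (fun l => m (p l)))
              (Fin.append (fun l => reflSite (q l) (x l)) y) : ℂ) := by
  classical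
  -- Step 1: the integrand, pointwise, as a six-fold finite sum
  have hpt : ∀ U : LGConfig 4 G,
      conj (∑ j, fieldObs r a B o (F j) m (cfgReflect U)) * ∑ j, fieldObs r a B o (F j) m U =
        ∑ i, ∑ j,
          ∑ q ∈ Fintype.piFinset (fun _ : Fin (deg i) => Finset.univ.filter fun pl : Fin 4 × Fin 4 => pl.1 < pl.2),
          ∑ p ∈ Fintype.piFinset (fun _ : Fin (deg j) => Finset.univ.filter fun pl : Fin 4 × Fin 4 => pl.1 < pl.2),
          ∑ x ∈ Fintype.piFinset (fun _ : Fin (deg i) => box 4 B),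
          ∑ y ∈ Fintype.piFinset (fun _ : Fin (deg j) => box 4 B),
            conj (F i (fun l => a • (siteToE (x l) + o (q l)))) * F j (fun l => a • (siteToE (y l) + o (p l))) *
              ((strObs r q (fun l => m (q l)) (fun l => reflSite (q l) (x l)) U *
                strObs r p (fun l => m (p l)) y U : ℝ) : ℂ) := by
    intro U
    simp only [map_sum]
    rw [Finset.sum_mul]
    refine Finset.sum_congr rfl fun i _ => ?_
    rw [Finset.mul_sum]
    refine Finset.sum_congr rfl fun j _ => ?_
    unfold fieldObs
    simp only [map_sum]
    rw [Finset.sum_mul]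
    refine Finset.sum_congr rfl fun q hq => ?_
    rw [Finset.mul_sum]
    refine Finset.sum_congr rfl fun p _ => ?_
    rw [Finset.sum_mul]
    refine Finset.sum_congr rfl fun x _ => ?_
    rw [Finset.mul_sum]
    refine Finset.sum_congr rfl fun y _ => ?_
    rw [map_mul, Complex.conj_ofReal, strObs_cfgReflect r ((mem_planeStrings_iff'' q).1 hq)]
    push_cast
    ring
  -- Step 2: integrate termwise
  simp_rw [hpt]
  rw [integral_finsetSum _ (fun i _ => ?_)]
  · refine Finset.sum_congr rfl fun i _ => ?_
    rw [integral_finsetSum _ (fun j _ => ?_)]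
    · refine Finset.sum_congr rfl fun j _ => ?_
      rw [integral_finsetSum _ (fun q _ => ?_)]
      · refine Finset.sum_congr rfl fun q _ => ?_
        rw [integral_finsetSum _ (fun p _ => ?_)]
        · refine Finset.sum_congr rfl fun p _ => ?_
          rw [integral_finsetSum _ (fun x _ => ?_)]
          · refine Finset.sum_congr rfl fun x _ => ?_
            rw [integral_finsetSum _ (fun y _ => ?_)]
            · refine Finset.sum_congr rfl fun y _ => ?_
              rw [integral_const_mul]
              congr 1
              simp_rw [strObs_mul_strObs]
              unfold strWeight
              exact integral_ofReal
            · exact integrable_rpTerm r μ _ q p _ _ _ _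
          · exact integrable_finsetSum _ fun y _ => integrable_rpTerm r μ _ q p _ _ _ _
        · exact integrable_finsetSum _ fun x _ => integrable_finsetSum _ fun y _ =>
            integrable_rpTerm r μ _ q p _ _ _ _
      · exact integrable_finsetSum _ fun p _ => integrable_finsetSum _ fun x _ =>
          integrable_finsetSum _ fun y _ => integrable_rpTerm r μ _ q p _ _ _ _
    · exact integrable_finsetSum _ fun q _ => integrable_finsetSum _ fun p _ =>
        integrable_finsetSum _ fun x _ => integrable_finsetSum _ fun y _ => integrable_rpTerm r μ _ q p _ _ _ _
  · exact integrable_finsetSum _ fun j _ => integrable_finsetSum _ fun q _ => integrable_finsetSum _ fun p _ =>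
      integrable_finsetSum _ fun x _ => integrable_finsetSum _ fun y _ => integrable_rpTerm r μ _ q p _ _ _ _

/-! ### The change of variables `x ↦ reflSite∘x` on the box -/

/-- **Time localisation**: for a test function with time support in `(0, T]`, offsets with time components in
`[0, 1)`, `a > 0` and `T + a ≤ a B`, a non-vanishing value `Gf (a (x + o∘q)) ≠ 0` forces `0 ≤ x_l⁰ ≤ B − 1`
for all `l` — so both `x` and its reflected sites `reflSite∘x` have time coordinates in `[−B, B]`. -/
theorem time_mem_of_apply_ne_zero {n : ℕ} {a T : ℝ} (ha : 0 < a) {B : ℕ} (hTB : T + a ≤ a * B)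
    {o : Fin 4 × Fin 4 → E4} (ho : ∀ q, 0 ≤ o q 0 ∧ o q 0 < 1) {Gf : (Fin n → E4) → ℂ}
    (hG : ∀ u : Fin n → E4, (∃ l, u l 0 ≤ 0 ∨ T < u l 0) → Gf u = 0) (q : Fin n → Fin 4 × Fin 4)
    {x : Fin n → Site 4} (hx : Gf (fun l => a • (siteToE (x l) + o (q l))) ≠ 0) (l : Fin n) :
    0 ≤ x l 0 ∧ x l 0 + 1 ≤ B := by
  by_contra h
  refine hx (hG _ ⟨l, ?_⟩)
  simp only [PiLp.smul_apply, PiLp.add_apply, siteToE_apply, smul_eq_mul]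
  rcases not_and_or.1 h with h | h
  · left
    have hy : (x l 0 : ℝ) ≤ -1 := by exact_mod_cast (show x l 0 ≤ -1 by omega)
    have h1 : (x l 0 : ℝ) + o (q l) 0 ≤ 0 := by linarith [(ho (q l)).2]
    exact mul_nonpos_iff.2 (Or.inl ⟨ha.le, h1⟩)
  · right
    have hy : (B : ℝ) ≤ x l 0 := by exact_mod_cast (show (B : ℤ) ≤ x l 0 by omega)
    have h1 : a * B ≤ a * ((x l 0 : ℝ) + o (q l) 0) := by nlinarith [(ho (q l)).1]
    linarith

/-- **The change of variables `x' = reflSite∘x`**: for `Gf` with time support in `(0, T]`, `T + a ≤ a B`, offsets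
with time components in `[0, 1)`:
`Σ_{x ∈ boxⁿ} Gf(a (x + o∘q)) Φ(reflSite∘x) = Σ_{x ∈ boxⁿ} Gf(a (reflSite∘x + o∘q)) Φ(x)`. -/
theorem sum_reflSite_eq {n : ℕ} {a T : ℝ} (ha : 0 < a) {B : ℕ} (hTB : T + a ≤ a * B)
    {o : Fin 4 × Fin 4 → E4} (ho : ∀ q, 0 ≤ o q 0 ∧ o q 0 < 1)
    (Gf : (Fin n → E4) → ℂ) (hG : ∀ u : Fin n → E4, (∃ l, u l 0 ≤ 0 ∨ T < u l 0) → Gf u = 0)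
    (q : Fin n → Fin 4 × Fin 4) (Φ : (Fin n → Site 4) → ℂ) :
    ∑ x ∈ Fintype.piFinset (fun _ : Fin n => box 4 B),
        Gf (fun l => a • (siteToE (x l) + o (q l))) * Φ (fun l => reflSite (q l) (x l)) =
      ∑ x ∈ Fintype.piFinset (fun _ : Fin n => box 4 B),
        Gf (fun l => a • (siteToE (reflSite (q l) (x l)) + o (q l))) * Φ x := by
  classical
  -- on the set where `Gf ≠ 0`, `x` and `reflSite∘x` are both in the box
  have key : ∀ x : Fin n → Site 4, Gf (fun l => a • (siteToE (x l) + o (q l))) ≠ 0 →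
      (x ∈ Fintype.piFinset (fun _ : Fin n => box 4 B) ↔
        (fun l => reflSite (q l) (x l)) ∈ Fintype.piFinset (fun _ : Fin n => box 4 B)) := by
    intro x hx
    have htime := time_mem_of_apply_ne_zero ha hTB ho hG q hx
    simp only [Fintype.mem_piFinset, mem_box]
    constructor
    · intro h l k
      by_cases hk : k = 0
      · subst hk; rw [reflSite_apply_zero]
        have := htime l
        split_ifs <;> constructor <;> omega
      · rw [reflSite_apply_of_ne _ _ hk]; exact h l k
    · intro h l k
      by_cases hk : k = 0
      · subst hk; have := htime l; constructor <;> omega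
      · have := h l k; rwa [reflSite_apply_of_ne _ _ hk] at this
  have hinv : ∀ x : Fin n → Site 4, (fun l => reflSite (q l) (reflSite (q l) (x l))) = x := fun x =>
    funext fun l => reflSite_reflSite _ _
  rw [← Finset.sum_filter_ne_zero (s := Fintype.piFinset (fun _ : Fin n => box 4 B)),
    ← Finset.sum_filter_ne_zero (s := Fintype.piFinset (fun _ : Fin n => box 4 B))
      (f := fun x => Gf (fun l => a • (siteToE (reflSite (q l) (x l)) + o (q l))) * Φ x)]
  refine Finset.sum_bij' (fun x _ => fun l => reflSite (q l) (x l)) (fun x _ => fun l => reflSite (q l) (x l))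
    (fun x hx => ?_) (fun x hx => ?_) (fun x _ => hinv x) (fun x _ => hinv x)
    (fun x _ => by simp only [reflSite_reflSite])
  · rw [Finset.mem_filter] at hx ⊢
    have hG0 : Gf (fun l => a • (siteToE (x l) + o (q l))) ≠ 0 := fun h => hx.2 (by rw [h, zero_mul])
    refine ⟨(key x hG0).1 hx.1, ?_⟩
    simp only [reflSite_reflSite]
    exact hx.2
  · rw [Finset.mem_filter] at hx ⊢
    have hG0 : Gf (fun l => a • (siteToE (reflSite (q l) (x l)) + o (q l))) ≠ 0 := fun h =>
      hx.2 (by rw [h, zero_mul])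
    refine ⟨?_, by simp only [reflSite_reflSite]; exact hx.2⟩
    have := (key (fun l => reflSite (q l) (x l)) hG0).2
    simp only [reflSite_reflSite] at this
    exact this hx.1

/-! ### The reindexed square -/

omit [IsTopologicalGroup G] [CompactSpace G] [BorelSpace G] in
/-- **The reindexed term of the reflection-positivity square.** For a test function `Fᵢ` of the first block with
time support in `(0, T]`, `T + a ≤ a B`, and offsets with time components in `[0, 1)`: the `(q, p)`-sum of
`integral_rpSquare_eq` equals the string sum at the ACTUAL sites with `Fᵢ` evaluated at the reflected points
`ϑ(a (x (rev l) + o (q (rev l)))) + a (2 (o (q (rev l)))₀ − [q (rev l) temporal]) e₀`. -/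
theorem rpTerm_eq_shifted (r : LatticeRep G) (μ : Measure (LGConfig 4 G)) {a T : ℝ} (ha : 0 < a) {B : ℕ}
    (hTB : T + a ≤ a * B) {o : Fin 4 × Fin 4 → E4} (ho : ∀ q, 0 ≤ o q 0 ∧ o q 0 < 1)
    {n k : ℕ} (Fi : 𝓢((Fin n → E4), ℂ))
    (hFi : ∀ u : Fin n → E4, (∃ l, u l 0 ≤ 0 ∨ T < u l 0) → Fi u = 0)
    (Fj : 𝓢((Fin k → E4), ℂ)) (m : Fin 4 × Fin 4 → ℝ) :
    ∑ q ∈ Fintype.piFinset (fun _ : Fin n => Finset.univ.filter fun pl : Fin 4 × Fin 4 => pl.1 < pl.2),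
      ∑ p ∈ Fintype.piFinset (fun _ : Fin k => Finset.univ.filter fun pl : Fin 4 × Fin 4 => pl.1 < pl.2),
      ∑ x ∈ Fintype.piFinset (fun _ : Fin n => box 4 B),
      ∑ y ∈ Fintype.piFinset (fun _ : Fin k => box 4 B),
        conj (Fi (fun l => a • (siteToE (x l) + o (q l)))) * Fj (fun l => a • (siteToE (y l) + o (p l))) *
          (strWeight r μ (Fin.append q p) (Fin.append (fun l => m (q l)) (fun l => m (p l)))
            (Fin.append (fun l => reflSite (q l) (x l)) y) : ℂ) =
    ∑ q ∈ Fintype.piFinset (fun _ : Fin n => Finset.univ.filter fun pl : Fin 4 × Fin 4 => pl.1 < pl.2),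
      ∑ p ∈ Fintype.piFinset (fun _ : Fin k => Finset.univ.filter fun pl : Fin 4 × Fin 4 => pl.1 < pl.2),
      ∑ x ∈ Fintype.piFinset (fun _ : Fin n => box 4 B),
      ∑ y ∈ Fintype.piFinset (fun _ : Fin k => box 4 B),
        conj (Fi (fun l => timeReflection 4 (a • (siteToE (x (Fin.rev l)) + o (q (Fin.rev l)))) +
            (a * (2 * o (q (Fin.rev l)) 0 - if (q (Fin.rev l)).1 = 0 then 1 else 0)) •
              EuclideanSpace.single (0 : Fin 4) (1 : ℝ))) *
          Fj (fun l => a • (siteToE (y l) + o (p l))) *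
          (strWeight r μ (Fin.append q p) (Fin.append (fun l => m (q l)) (fun l => m (p l)))
            (Fin.append x y) : ℂ) := by
  classical
  -- Step 1: reverse the first block (`q ↦ q ∘ rev`, `x ↦ x ∘ rev`) — a bijection of both index sets
  rw [← sum_piFinset_comp_perm _ Fin.revPerm]
  refine Finset.sum_congr rfl fun q _ => Finset.sum_congr rfl fun p _ => ?_
  rw [← sum_piFinset_comp_perm _ Fin.revPerm]
  -- Step 2: the weights are invariant under the joint reversal of the first block
  have hW : ∀ (x : Fin n → Site 4) (y : Fin k → Site 4),
      strWeight r μ (Fin.append (q ∘ ⇑Fin.revPerm) p)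
        (Fin.append (fun l => m ((q ∘ ⇑Fin.revPerm) l)) (fun l => m (p l)))
        (Fin.append (fun l => reflSite ((q ∘ ⇑Fin.revPerm) l) ((x ∘ ⇑Fin.revPerm) l)) y) =
      strWeight r μ (Fin.append q p) (Fin.append (fun l => m (q l)) (fun l => m (p l)))
        (Fin.append (fun l => reflSite (q l) (x l)) y) := by
    intro x y
    rw [← strWeight_comp_perm r μ (Fin.append q p) _ (Fin.append (fun l => reflSite (q l) (x l)) y) (revFirst n k)]
    congr 1
    · rw [append_comp_revFirst]; rfl
    · rw [append_comp_revFirst]; rfl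
    · rw [append_comp_revFirst]; rfl
  simp_rw [hW]
  -- Step 3: exchange the `x`- and `y`-sums and change variables `x ↦ reflSite∘x` in the `x`-sum
  rw [Finset.sum_comm]
  conv_rhs => rw [Finset.sum_comm]
  refine Finset.sum_congr rfl fun y _ => ?_
  have h := sum_reflSite_eq ha hTB ho
    (fun u => conj (Fi (u ∘ Fin.rev)) * Fj (fun l => a • (siteToE (y l) + o (p l))))
    (fun u hu => by
      obtain ⟨l, hl⟩ := hu
      beta_reduce
      rw [hFi (u ∘ Fin.rev) ⟨Fin.rev l, by simpa using hl⟩, map_zero, zero_mul]) q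
    (fun x => (strWeight r μ (Fin.append q p) (Fin.append (fun l => m (q l)) (fun l => m (p l)))
      (Fin.append x y) : ℂ))
  refine (Finset.sum_congr rfl fun x _ => ?_).trans (h.trans (Finset.sum_congr rfl fun x _ => ?_))
  · rfl
  · congr 3
    congr 1
    funext l
    simp only [Function.comp_apply]
    exact smul_reflSite_add a _ _ _

end Summit.QuantumFields.YangMills.Theorems.InfVolRP

end
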